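import Summits.ResolutionOfSingularities.ResolutionOfSingularities.Theses.Dominance
import Summits.ResolutionOfSingularities.ResolutionOfSingularities.Theses.FactorialLadder
import Summits.ResolutionOfSingularities.ResolutionOfSingularities.Theses.WildQuotients
import Summits.ResolutionOfSingularities.ResolutionOfSingularities.Theorems.GaloisWebClasses
import Literature.Barriers.ResolutionOfSingularities.DimensionFourFrontier
import HarnessLib

/-!
# DominanceGaloisWeb — kernels of the decomp-res node «GaloisWeb» (lens-4 g6) BY NAME

Source HOME/decomp-res-lens-4/g6/GaloisWeb.lean (sha256 62269666e3f28ddf, critic `lean check` rc 0 · 0 sorry ·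
axioms
standard), CRITIC-LEDGER row 41 (2026-08-30T06:08:04Z): CLEARED AS CHILD NODE with decided carving — «dim-4 k̄
slice ⟸
CP2019 ∧ WebNormalForm ∧ TameWebResolve ∧ WildWebResolve; layer 2 W ⟸ R ∧ E ∧ S ∧ WQ4 = 15640|₄».  The pieces are
the
route asides `Dominance.ResolutionDimFourAlgClosed` (target slice = the hypothesis of `FactorialLadder.DescentFour`,
stmt-23684), `Dominance.WebNormalForm` (N, KNOWN-MOD-PORT), `Dominance.TameWebResolve` (T, KNOWN-MOD-PORT, census
T-web-tame), `Dominance.WildWebResolve` (W, located RESIDUAL), `Dominance.EquivariantLogResolutionThree` (E, flag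
«dim-3,
not summit-implied», census T-eqres3), `Dominance.EquivariantSemiStableResolution` (S, port),
`Dominance.WildQuotientResolutionFourClosed` (WQ4 = `WildQuotients.WildQuotientResolution` 15640 ∩ {k̄, dim ≤ 4})
and
`Dominance.WildWebReduction` (R : E → S → WQ4 → W), stated over the route-independent notions of
`Theorems/GaloisWebClasses.lean` (`GaloisWeb`, `TameStabilizers`, `HasWeb`, `HasTameWeb`).

Kernels (all BY NAME, 0 sorry):
* `closes` : CP2019 → N → T → W → target slice (case split `dim ≤ 3` / tame web / wild web; every hypothesis
consumed);
  `closes₂` with the layer-2 split; `wild_of_layer2` (definitional);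
* necessity: `target_of_root` (ROOT ⇒ slice), `tame_of_target`, `wild_of_target`, `wq4_of_target`;
  `wq4_of_wildQuotientResolution` (WQ4 is a literal specialisation of stmt-15640);
* exactness `target_iff` : modulo the ports CP2019 and N, slice ↔ T ∧ W;
* upward assembly `root_of` : CP2019 → N → T → W → `FactorialLadder.DescentFour` (23684) →
`FactorialLadder.ResGeFive`
  (23685) → ROOT (same case split as `FactorialLadder.closes`).
Why this is novel: de Jong's curve-fibration normal form, made `G`-equivariant over a THREE-dimensional regular snc
base
(where CP2019/CJS2020 supply the base resolution AdJ 1997 had to assume), cuts the dim-4 k̄ slice into a decided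
TAME
class and a located WILD residual = wild quotient models of curve families (AdJ 1997 §1.3.2's obstruction).
[DeJong1996 §4.11–4.28; AbramovichJong1996 §1.3.2, §2; CossartPiltant2019 Thm. 1.1, Prop. 4.4;
CossartJannsenSaito2020
Thm. 6.9; Kato1994 Thm. 8.2; SGA1 V.1.8]
-/

open CategoryTheory CategoryTheory.Limits AlgebraicGeometry TopologicalSpace Topology
open Literature.AlgebraicGeometry.Resolution
open Summit.ResolutionOfSingularities.ResolutionOfSingularities.Theses
open Summit.ResolutionOfSingularities.ResolutionOfSingularities.Theorems.GaloisWebClasses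

namespace Summit.ResolutionOfSingularities.ResolutionOfSingularities.Theorems.DominanceGaloisWeb

/-! ## Deciding theorems -/

/-- **closes** (layer 1): CP2019 ∧ N ∧ T ∧ W ⇒ the target slice; every hypothesis is consumed (CP: `dim ≤ 3`; T:
tame
web; N + W: otherwise). [cite: CossartPiltant2019, Thm. 1.1] -/
theorem closes (hCP : CossartPiltant2019.{0}) (hN : Dominance.WebNormalForm) (hT : Dominance.TameWebResolve)
    (hW : Dominance.WildWebResolve) : Dominance.ResolutionDimFourAlgClosed := by
  intro p hp k _ _ _
  apply ResolutionOverUpToDim.of_projective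
  intro n X ι hι hX hdim
  by_cases h3 : topologicalKrullDim X ≤ 3
  · haveI := hι
    haveI := hX
    exact (cossartPiltant2019_iff.mp hCP k).projective n X ι h3
  · by_cases ht : HasTameWeb k p X
    · exact hT p hp k n X ι hι hX hdim ht
    · exact hW p hp k n X ι hι hX hdim ht (hN p hp k n X ι hι hX hdim h3)

/-- **closes₂** (layer 1 with the residual split): CP ∧ N ∧ T ∧ R ∧ E ∧ S ∧ WQ4 ⇒ the target slice. -/
theorem closes₂ (hCP : CossartPiltant2019.{0}) (hN : Dominance.WebNormalForm) (hT : Dominance.TameWebResolve)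
    (hR : Dominance.WildWebReduction) (hE : Dominance.EquivariantLogResolutionThree)
    (hS : Dominance.EquivariantSemiStableResolution) (hQ : Dominance.WildQuotientResolutionFourClosed) :
    Dominance.ResolutionDimFourAlgClosed :=
  closes hCP hN hT (hR hE hS hQ)

/-- The residual split as an implication (definitional unfolding of R). -/
theorem wild_of_layer2 (hR : Dominance.WildWebReduction) (hE : Dominance.EquivariantLogResolutionThree)
    (hS : Dominance.EquivariantSemiStableResolution) (hQ : Dominance.WildQuotientResolutionFourClosed) :
    Dominance.WildWebResolve :=
  hR hE hS hQ

/-! ## Necessity kernels (every non-port piece is implied by the target slice / the root) -/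

/-- The target slice is necessary for the root (Literature: `resolutionOverUpToDim_of_resolutionInChar`). -/
theorem target_of_root (h : _root_.ResolutionOfSingularities) : Dominance.ResolutionDimFourAlgClosed :=
  fun p hp k _ _ _ =>
    Literature.Barriers.ResolutionOfSingularities.resolutionOverUpToDim_of_resolutionInChar (h p hp) k 4

/-- T is necessary: WEAKER than the slice. -/
theorem tame_of_target (h : Dominance.ResolutionDimFourAlgClosed) : Dominance.TameWebResolve := by
  intro p hp k _ _ _ n X ι hι hX hdim _
  haveI := hι
  haveI := hX
  exact (h p hp k).projective n X ι hdim

/-- W is necessary: WEAKER than the slice. -/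
theorem wild_of_target (h : Dominance.ResolutionDimFourAlgClosed) : Dominance.WildWebResolve := by
  intro p hp k _ _ _ n X ι hι hX hdim _ _
  haveI := hι
  haveI := hX
  exact (h p hp k).projective n X ι hdim

/-- WQ4 is necessary: WEAKER than the slice. -/
theorem wq4_of_target (h : Dominance.ResolutionDimFourAlgClosed) : Dominance.WildQuotientResolutionFourClosed := by
  intro p hp k _ _ _ X' X₁ f q G _ _ ρ hs hl hq hint _ _ _ _ _ _ _ hdim
  haveI := hint
  exact h p hp k X₁ f hs hl hq inferInstance hdim

/-- WQ4 is a literal specialisation of the F1 crux `WildQuotients.WildQuotientResolution` (stmt-15640): CONVERGENCE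
BY
NAME with the WildQuotients route. -/
theorem wq4_of_wildQuotientResolution (h : WildQuotients.WildQuotientResolution) :
    Dominance.WildQuotientResolutionFourClosed := by
  intro p hp k _ _ _ X' X₁ f q G _ _ ρ hs hl hq hint hint' hreg hfin hsurj het hinv htr _
  exact h p hp k X' X₁ f q G ρ hs hl hq hint hint' hreg hfin hsurj het hinv htr

/-- **EXACTNESS** (the one EQUIV layer): modulo the ports CP2019 and N, the target slice is equivalent to T ∧ W. -/
theorem target_iff (hCP : CossartPiltant2019.{0}) (hN : Dominance.WebNormalForm) :
    Dominance.ResolutionDimFourAlgClosed ↔ (Dominance.TameWebResolve ∧ Dominance.WildWebResolve) :=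
  ⟨fun h => ⟨tame_of_target h, wild_of_target h⟩, fun h => closes hCP hN h.1 h.2⟩

/-- With the layer-2 split: modulo CP2019, N, R, E, S, the target slice is equivalent to T ∧ WQ4. -/
theorem target_iff₂ (hCP : CossartPiltant2019.{0}) (hN : Dominance.WebNormalForm) (hR : Dominance.WildWebReduction)
    (hE : Dominance.EquivariantLogResolutionThree) (hS : Dominance.EquivariantSemiStableResolution) :
    Dominance.ResolutionDimFourAlgClosed ↔
      (Dominance.TameWebResolve ∧ Dominance.WildQuotientResolutionFourClosed) :=
  ⟨fun h => ⟨tame_of_target h, wq4_of_target h⟩, fun h => closes₂ hCP hN h.1 hR hE hS h.2⟩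

/-! ## Upward assembly BY NAME -/

/-- **root_of**: the node's pieces together with `FactorialLadder.DescentFour` (stmt-23684) and
`FactorialLadder.ResGeFive` (stmt-23685) give the ROOT (same case split as `FactorialLadder.closes`). -/
theorem root_of (hCP : CossartPiltant2019.{0}) (hN : Dominance.WebNormalForm) (hT : Dominance.TameWebResolve)
    (hW : Dominance.WildWebResolve) (hD : FactorialLadder.DescentFour) (h5 : FactorialLadder.ResGeFive) :
    _root_.ResolutionOfSingularities := by
  intro p hp k _ _ X f hs hl hq hr
  by_cases hd : topologicalKrullDim X ≤ 4
  · have h4 : ResolutionOverUpToDim.{0} k 4 :=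
      hD p hp (fun k' _ _ _ => closes hCP hN hT hW p hp k') k
    exact h4 X f hs hl hq hr (by exact_mod_cast hd)
  · exact h5 p hp k X f hs hl hq hr hd

/-- ROOT from the layer-2 pieces and the FactorialLadder descent/≥5 items, via the WildQuotients crux 15640 for
WQ4. -/
theorem root_of_layer2 (hCP : CossartPiltant2019.{0}) (hN : Dominance.WebNormalForm) (hT : Dominance.TameWebResolve)
    (hR : Dominance.WildWebReduction) (hE : Dominance.EquivariantLogResolutionThree)
    (hS : Dominance.EquivariantSemiStableResolution) (hWQ : WildQuotients.WildQuotientResolution)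
    (hD : FactorialLadder.DescentFour) (h5 : FactorialLadder.ResGeFive) : _root_.ResolutionOfSingularities :=
  root_of hCP hN hT (hR hE hS (wq4_of_wildQuotientResolution hWQ)) hD h5

end Summit.ResolutionOfSingularities.ResolutionOfSingularities.Theorems.DominanceGaloisWeb
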